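import Summits.ValiantsHypothesis.ValiantsHypothesis.Theorems.LaplaceOptimalFive.Negative.SignPatternCheap
import Summits.ValiantsHypothesis.ValiantsHypothesis.Theorems.RigidityForcesSymmetryRankRigidMinimalReprLaplaceFiveSectorSplitDefs

/-!
# The sector cut versus the sign knife, BY THEOREM: side-symmetric systems have zero `S₅`-alternant
# (Negative lane of stmt-ValiantsHypothesis-24813 `LaplaceOptimalFive`; val-neg-2 g2, refuter; calibration of LINE `shallow_collision`
#  rev 4 — stubs S2′ `stub_sideSym_offShell_five`, S3′ `stub_minimalAsym_five` — and of young-shadow K1 / K2,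
#  `…LaplaceFiveSectorSplitDefs.{SideSymLaplaceOptimalFive, AsymLaplaceOptimalFive}`)

The rev-4 skeleton of the line (`Cruxes/LaplaceOptimalFive/Lines/shallow_collision.lean`, val-idea-19 g7) and its critic of record
(val-idea-crit-3 g4) state in prose: «`D₅` admits NO side-symmetric split decomposition at all (sign projector), hence the
`D₅`-instance of S2′ is VACUOUS and the `D₅`-instance of S3′ is FALSE: S3′ carries the whole sign knife, S2′ none of it».  This file
is the kernel certificate of those sentences, with the one-line mechanism made explicit and slightly more general.

MECHANISM (`alternant_eq_zero_of_swap_invariant`, `exists_swap_of_sideSymmetric_term`).  A split term `u ⊗_S w` whose short factor is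
slot-symmetric on `S` and whose long factor is slot-symmetric on `Sᶜ` (`LaplaceFiveSectorSplit.SlotInvariantOn`, BY NAME) is invariant
under the slot transposition of two slots on the same side (one side has `≥ 2` slots since `|S| + |Sᶜ| = 5`); a function on words
invariant under one slot transposition has zero alternant `Σ_σ sgn(σ)·f(σ)` (re-index the sum by `σ ↦ σ·(i j)`).  Hence
(`alternant_target_eq_zero_of_sideSymmetric`) every target `F` of a SIDE-SYMMETRIC split-rank-one family satisfies
`Σ_{σ ∈ S₅} sgn(σ)·F(σ) = 0` — whatever the weight, whatever `F` does off the permutations.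

CONSEQUENCES (all kernel-checked here; `D` = any target agreeing with `sgn` on the permutations — for the results that need a cheap
decomposition also `D = 0` off them, which pins the determinant pattern `D₅`; its weight-`72` decomposition is
`SignPatternCheap.sign_five_cheap`, ✓ p646934):
* `no_sideSymmetric_of_signPattern` : NO side-symmetric split-rank-one family sums to `D` (alternant `= 120 ≠ 0`).  So young-shadow
  K1 and the line's S2′, read for `D₅` instead of `P₅`, hold VACUOUSLY (`sideSym_signPattern_vacuous`): the sign knife
  (`SignBlindBarrier.signBlind_le_72`, ✓ p650988) does not touch the symmetric sector.
* `not_minimalAsym_of_signPattern` : the `D₅`-reading of S3′ («an exact system that is WEIGHT-MINIMAL among all exact systems and NOT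
  side-symmetric has weight `≥ 120`») is FALSE: a weight-minimal exact system for `D₅` exists (`Nat.find` over the exact weights,
  `≤ 72` by `sign_five_cheap`), and it is not side-symmetric by the alternant.  In the `_false_without_` dialect: any proof of S3′ must
  use a property of the TARGET `P₅` that fails for `D₅` — its hypothesis set `WeightMinimal ∧ ¬ SideSymmetric` is inhabited below
  `120` once the target's signs are flipped to `sgn`.  Likewise `not_asym_of_signPattern`: the `D₅`-reading of K2 is false.
* `alternant_signs_eq_zero_of_sideSymmetric` : for a general `±`-rescaled target `[v injective]·ε(v)` a side-symmetric decomposition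
  (of any weight) forces `Σ_σ sgn(σ) ε(σ) = 0`; `alternant_perm_pattern_eq_zero` : for `P₅` itself (`ε ≡ 1`) the alternant test is
  silent, as it must be — the symmetric sector of `P₅` is inhabited at weight `120` by the Laplace expansions.

HONEST FRAMING.  Calibration lemmas about the SIGNED pattern; nothing here proves or refutes `LaplaceOptimalFive` (stmt-24813, `P₅`),
which stays OPEN · CONTESTED 72/120; S2′ / S3′ / K1 / K2 for `P₅` are untouched; `RankRigidMinimalRepr` (18034) does not move;
VP ≠ VNP is NOT proved.  No new definitions.
-/

set_option autoImplicit false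

-- the mandated summit-side namespace repeats a component by design (single-problem summit)
set_option linter.dupNamespace false

namespace Summit.ValiantsHypothesis.ValiantsHypothesis.Theorems.LaplaceOptimalFiveNegative.SectorSignCalibration

open Finset
open Summit.ValiantsHypothesis.ValiantsHypothesis.Theorems.LaplaceOptimalFiveNegative.SignPatternCheap
  (sign_five_cheap levi_five_eq_zero levi_five_perm)
open Summit.ValiantsHypothesis.ValiantsHypothesis.Theorems.RigidityForcesSymmetryRankRigidMinimalRepr.LaplaceFiveSectorSplit
  (SlotInvariantOn SideSymmetric)

/-- **Alternant of a transposition-invariant function vanishes.**  If `f` on words is invariant under the slot transposition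
`(i j)`, then `Σ_{σ ∈ S₅} sgn(σ)·f(σ) = 0` (re-index by `σ ↦ σ·(i j)`, which flips the sign). -/
theorem alternant_eq_zero_of_swap_invariant (f : (Fin 5 → Fin 5) → ℂ) {i j : Fin 5} (hij : i ≠ j)
    (hf : ∀ v : Fin 5 → Fin 5, f (v ∘ ⇑(Equiv.swap i j)) = f v) :
    ∑ σ : Equiv.Perm (Fin 5), (((Equiv.Perm.sign σ : ℤˣ) : ℤ) : ℂ) * f ⇑σ = 0 := by
  set s := ∑ σ : Equiv.Perm (Fin 5), (((Equiv.Perm.sign σ : ℤˣ) : ℤ) : ℂ) * f ⇑σ with hs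
  have hre : ∑ σ : Equiv.Perm (Fin 5),
      (((Equiv.Perm.sign (σ * Equiv.swap i j) : ℤˣ) : ℤ) : ℂ) * f ⇑(σ * Equiv.swap i j) = s :=
    Fintype.sum_equiv (Equiv.mulRight (Equiv.swap i j))
      (fun σ => (((Equiv.Perm.sign (σ * Equiv.swap i j) : ℤˣ) : ℤ) : ℂ) * f ⇑(σ * Equiv.swap i j))
      (fun σ => (((Equiv.Perm.sign σ : ℤˣ) : ℤ) : ℂ) * f ⇑σ) (fun _ => rfl)
  have hneg : ∑ σ : Equiv.Perm (Fin 5),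
      (((Equiv.Perm.sign (σ * Equiv.swap i j) : ℤˣ) : ℤ) : ℂ) * f ⇑(σ * Equiv.swap i j) = -s := by
    rw [hs, ← Finset.sum_neg_distrib]
    refine Finset.sum_congr rfl (fun σ _ => ?_)
    rw [Equiv.Perm.sign_mul, Equiv.Perm.sign_swap hij, Equiv.Perm.coe_mul, hf ⇑σ, Units.val_mul, Units.val_neg,
      Units.val_one]
    push_cast
    ring
  have h : s = -s := hre.symm.trans hneg
  linear_combination h / 2

/-- **A side-symmetric split term is invariant under a slot transposition on one of its sides.**  `u` reads only the slots of `A`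
and is slot-symmetric there, `w` reads only the slots off `A` and is slot-symmetric there; one of the two sides has two slots. -/
theorem exists_swap_of_sideSymmetric_term (A : Finset (Fin 5)) (u w : (Fin 5 → Fin 5) → ℂ)
    (hu : ∀ v v' : Fin 5 → Fin 5, (∀ i ∈ A, v i = v' i) → u v = u v')
    (hw : ∀ v v' : Fin 5 → Fin 5, (∀ i, i ∉ A → v i = v' i) → w v = w v')
    (hsu : SlotInvariantOn A u) (hsw : SlotInvariantOn Aᶜ w) :
    ∃ i j : Fin 5, i ≠ j ∧ ∀ v : Fin 5 → Fin 5,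
      u (v ∘ ⇑(Equiv.swap i j)) * w (v ∘ ⇑(Equiv.swap i j)) = u v * w v := by
  by_cases hA : 1 < A.card
  · obtain ⟨i, hi, j, hj, hij⟩ := Finset.one_lt_card.mp hA
    refine ⟨i, j, hij, fun v => ?_⟩
    have hfix : ∀ k, k ∉ A → Equiv.swap i j k = k := fun k hk =>
      Equiv.swap_apply_of_ne_of_ne (fun h => hk (by rw [h]; exact hi)) (fun h => hk (by rw [h]; exact hj))
    rw [hsu (Equiv.swap i j) hfix v,
      hw (v ∘ ⇑(Equiv.swap i j)) v (fun k hk => by show v (Equiv.swap i j k) = v k; rw [hfix k hk])]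
  · have hAc : 1 < Aᶜ.card := by
      rw [Finset.card_compl, Fintype.card_fin]; omega
    obtain ⟨i, hi, j, hj, hij⟩ := Finset.one_lt_card.mp hAc
    rw [Finset.mem_compl] at hi hj
    refine ⟨i, j, hij, fun v => ?_⟩
    have hfix : ∀ k, k ∈ A → Equiv.swap i j k = k := fun k hk =>
      Equiv.swap_apply_of_ne_of_ne (fun h => hi (by rw [← h]; exact hk)) (fun h => hj (by rw [← h]; exact hk))
    rw [hsw (Equiv.swap i j) (fun k hk => hfix k (by simpa [Finset.mem_compl] using hk)) v,
      hu (v ∘ ⇑(Equiv.swap i j)) v (fun k hk => by show v (Equiv.swap i j k) = v k; rw [hfix k hk])]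

/-- **Side-symmetric split-rank-one families have zero alternant** (any number of terms, any profile, no exactness assumed):
`Σ_σ sgn(σ) · Σ_{t ∈ T} u_t(σ) w_t(σ) = 0`.  Hypotheses: the two locality clauses of `LaplaceOptimal 5` and
`LaplaceFiveSectorSplit.SideSymmetric` BY NAME. -/
theorem alternant_eq_zero_of_sideSymmetric {N : ℕ} (T : Finset (Fin N)) (S : Fin N → Finset (Fin 5))
    (u w : Fin N → (Fin 5 → Fin 5) → ℂ)
    (hu : ∀ t, ∀ v v' : Fin 5 → Fin 5, (∀ i ∈ S t, v i = v' i) → u t v = u t v')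
    (hw : ∀ t, ∀ v v' : Fin 5 → Fin 5, (∀ i, i ∉ S t → v i = v' i) → w t v = w t v')
    (hsym : SideSymmetric T S u w) :
    ∑ σ : Equiv.Perm (Fin 5), (((Equiv.Perm.sign σ : ℤˣ) : ℤ) : ℂ) * ∑ t ∈ T, u t ⇑σ * w t ⇑σ = 0 := by
  simp_rw [Finset.mul_sum]
  rw [Finset.sum_comm]
  refine Finset.sum_eq_zero (fun t ht => ?_)
  obtain ⟨i, j, hij, hinv⟩ :=
    exists_swap_of_sideSymmetric_term (S t) (u t) (w t) (hu t) (hw t) (hsym t ht).1 (hsym t ht).2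
  exact alternant_eq_zero_of_swap_invariant (fun v => u t v * w t v) hij hinv

/-- **The alternant of the TARGET of a side-symmetric family vanishes**: if `Σ_t u_t ⊗ w_t = F` pointwise then
`Σ_σ sgn(σ) F(σ) = 0`. -/
theorem alternant_target_eq_zero_of_sideSymmetric {N : ℕ} (T : Finset (Fin N)) (S : Fin N → Finset (Fin 5))
    (u w : Fin N → (Fin 5 → Fin 5) → ℂ)
    (hu : ∀ t, ∀ v v' : Fin 5 → Fin 5, (∀ i ∈ S t, v i = v' i) → u t v = u t v')
    (hw : ∀ t, ∀ v v' : Fin 5 → Fin 5, (∀ i, i ∉ S t → v i = v' i) → w t v = w t v')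
    (hsym : SideSymmetric T S u w) (F : (Fin 5 → Fin 5) → ℂ)
    (hid : ∀ v : Fin 5 → Fin 5, (∑ t ∈ T, u t v * w t v) = F v) :
    ∑ σ : Equiv.Perm (Fin 5), (((Equiv.Perm.sign σ : ℤˣ) : ℤ) : ℂ) * F ⇑σ = 0 := by
  have h := alternant_eq_zero_of_sideSymmetric T S u w hu hw hsym
  simpa only [hid] using h

/-- **For a `±`-rescaled pattern `[v injective]·ε(v)`, a side-symmetric decomposition of ANY weight forces balanced signs**:
`Σ_σ sgn(σ) ε(σ) = 0`.  (Reach of the alternant test inside the sign-blind class of `SignBlindBarrier`.) -/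
theorem alternant_signs_eq_zero_of_sideSymmetric (ε : (Fin 5 → Fin 5) → ℂ) {N : ℕ} (T : Finset (Fin N))
    (S : Fin N → Finset (Fin 5)) (u w : Fin N → (Fin 5 → Fin 5) → ℂ)
    (hu : ∀ t, ∀ v v' : Fin 5 → Fin 5, (∀ i ∈ S t, v i = v' i) → u t v = u t v')
    (hw : ∀ t, ∀ v v' : Fin 5 → Fin 5, (∀ i, i ∉ S t → v i = v' i) → w t v = w t v')
    (hsym : SideSymmetric T S u w)
    (hid : ∀ v : Fin 5 → Fin 5, (∑ t ∈ T, u t v * w t v) = if Function.Injective v then ε v else 0) :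
    ∑ σ : Equiv.Perm (Fin 5), (((Equiv.Perm.sign σ : ℤˣ) : ℤ) : ℂ) * ε ⇑σ = 0 := by
  have h := alternant_target_eq_zero_of_sideSymmetric T S u w hu hw hsym _ hid
  have h' : ∀ σ : Equiv.Perm (Fin 5), (if Function.Injective (⇑σ) then ε ⇑σ else 0) = ε ⇑σ :=
    fun σ => if_pos σ.injective
  simpa only [h'] using h

/-- **The alternant test is silent on `P₅` itself** (`ε ≡ 1`): `Σ_σ sgn(σ) = 0` — consistent with the symmetric sector of `P₅`
being inhabited (at weight `120`, by the Laplace expansions). -/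
theorem alternant_perm_pattern_eq_zero :
    ∑ σ : Equiv.Perm (Fin 5), (((Equiv.Perm.sign σ : ℤˣ) : ℤ) : ℂ) = 0 := by
  have h := alternant_eq_zero_of_swap_invariant (fun _ => (1 : ℂ)) (i := 0) (j := 1) (by decide) (fun _ => rfl)
  simpa using h

/-- **No side-symmetric split-rank-one family sums to a target that agrees with `sgn` on the permutations** (in particular to
the determinant pattern `D₅`): its alternant would be `Σ_σ sgn(σ)² = 120 ≠ 0`.  Weight plays no role. -/
theorem no_sideSymmetric_of_signPattern (D : (Fin 5 → Fin 5) → ℂ)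
    (hDσ : ∀ σ : Equiv.Perm (Fin 5), D ⇑σ = (((Equiv.Perm.sign σ : ℤˣ) : ℤ) : ℂ))
    {N : ℕ} (T : Finset (Fin N)) (S : Fin N → Finset (Fin 5)) (u w : Fin N → (Fin 5 → Fin 5) → ℂ)
    (hu : ∀ t, ∀ v v' : Fin 5 → Fin 5, (∀ i ∈ S t, v i = v' i) → u t v = u t v')
    (hw : ∀ t, ∀ v v' : Fin 5 → Fin 5, (∀ i, i ∉ S t → v i = v' i) → w t v = w t v')
    (hsym : SideSymmetric T S u w)
    (hid : ∀ v : Fin 5 → Fin 5, (∑ t ∈ T, u t v * w t v) = D v) : False := by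
  have h0 := alternant_target_eq_zero_of_sideSymmetric T S u w hu hw hsym D hid
  have h1 : ∀ σ : Equiv.Perm (Fin 5), (((Equiv.Perm.sign σ : ℤˣ) : ℤ) : ℂ) * D ⇑σ = 1 := by
    intro σ
    rw [hDσ σ]
    rcases Int.units_eq_one_or (Equiv.Perm.sign σ) with h | h <;> simp [h]
  simp only [h1, Finset.sum_const, Finset.card_univ, Fintype.card_perm, Fintype.card_fin, nsmul_eq_mul, mul_one] at h0
  norm_num [Nat.factorial] at h0

/-- The inline Levi-Civita product of `SignPatternCheap` (the target of `sign_five_cheap`) IS any such `D` that moreover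
vanishes off the permutations — i.e. `D = D₅`. -/
theorem levi_eq_signPattern (D : (Fin 5 → Fin 5) → ℂ)
    (hDσ : ∀ σ : Equiv.Perm (Fin 5), D ⇑σ = (((Equiv.Perm.sign σ : ℤˣ) : ℤ) : ℂ))
    (hD0 : ∀ v : Fin 5 → Fin 5, ¬ Function.Injective v → D v = 0) (v : Fin 5 → Fin 5) :
    ((((if v 0 < v 1 then (1:ℤ) else if v 1 < v 0 then (-1:ℤ) else 0) * (if v 0 < v 2 then (1:ℤ) else if v 2 < v 0 then (-1:ℤ) else 0) * (if v 0 < v 3 then (1:ℤ) else if v 3 < v 0 then (-1:ℤ) else 0) * (if v 0 < v 4 then (1:ℤ) else if v 4 < v 0 then (-1:ℤ) else 0) * (if v 1 < v 2 then (1:ℤ) else if v 2 < v 1 then (-1:ℤ) else 0) * (if v 1 < v 3 then (1:ℤ) else if v 3 < v 1 then (-1:ℤ) else 0) * (if v 1 < v 4 then (1:ℤ) else if v 4 < v 1 then (-1:ℤ) else 0) * (if v 2 < v 3 then (1:ℤ) else if v 3 < v 2 then (-1:ℤ) else 0) * (if v 2 < v 4 then (1:ℤ) else if v 4 < v 2 then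 (-1:ℤ) else 0) * (if v 3 < v 4 then (1:ℤ) else if v 4 < v 3 then (-1:ℤ) else 0)) : ℤ) : ℂ)
      = D v := by
  by_cases hv : Function.Injective v
  · have hbij : Function.Bijective v := Finite.injective_iff_bijective.mp hv
    have key := levi_five_perm (Equiv.ofBijective v hbij)
    have hD := hDσ (Equiv.ofBijective v hbij)
    simp only [Equiv.ofBijective_apply] at key
    rw [Equiv.coe_ofBijective] at hD
    rw [hD, key]
  · rw [levi_five_eq_zero v hv, hD0 v hv]
    simp

/-- **A cheap exact split-rank-one family for `D`** (any `D` agreeing with `sgn` on permutations and `0` off them): weight `72 < 120`,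
transported from `SignPatternCheap.sign_five_cheap`. -/
theorem exists_cheap_of_signPattern (D : (Fin 5 → Fin 5) → ℂ)
    (hDσ : ∀ σ : Equiv.Perm (Fin 5), D ⇑σ = (((Equiv.Perm.sign σ : ℤˣ) : ℤ) : ℂ))
    (hD0 : ∀ v : Fin 5 → Fin 5, ¬ Function.Injective v → D v = 0) :
    ∃ (T : Finset (Fin 5)) (S : Fin 5 → Finset (Fin 5)) (u w : Fin 5 → (Fin 5 → Fin 5) → ℂ),
      (∀ t, ∀ v v' : Fin 5 → Fin 5, (∀ i ∈ S t, v i = v' i) → u t v = u t v') ∧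
      (∀ t, ∀ v v' : Fin 5 → Fin 5, (∀ i, i ∉ S t → v i = v' i) → w t v = w t v') ∧
      (∑ t ∈ T, (S t).card.factorial * (5 - (S t).card).factorial) = 72 ∧
      ∀ v : Fin 5 → Fin 5, (∑ t ∈ T, u t v * w t v) = D v := by
  obtain ⟨T, S, u, w, hu, hw, hwt, -, hid⟩ := sign_five_cheap
  exact ⟨T, S, u, w, hu, hw, hwt, fun v => by rw [hid v]; exact levi_eq_signPattern D hDσ hD0 v⟩

/-- **K1 / S2′ read for `D₅` are VACUOUS**: every side-symmetric exact family for `D` has weight `≥ 120` — because there is none.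
(Stated with the off-shell clause of S2′ dropped, which only strengthens it.) -/
theorem sideSym_signPattern_vacuous (D : (Fin 5 → Fin 5) → ℂ)
    (hDσ : ∀ σ : Equiv.Perm (Fin 5), D ⇑σ = (((Equiv.Perm.sign σ : ℤˣ) : ℤ) : ℂ)) :
    ∀ (N : ℕ) (T : Finset (Fin N)) (S : Fin N → Finset (Fin 5)) (u w : Fin N → (Fin 5 → Fin 5) → ℂ),
      (∀ t, ∀ v v' : Fin 5 → Fin 5, (∀ i ∈ S t, v i = v' i) → u t v = u t v') →
      (∀ t, ∀ v v' : Fin 5 → Fin 5, (∀ i, i ∉ S t → v i = v' i) → w t v = w t v') →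
      (∀ v : Fin 5 → Fin 5, (∑ t ∈ T, u t v * w t v) = D v) →
      SideSymmetric T S u w →
      Nat.factorial 5 ≤ ∑ t ∈ T, (S t).card.factorial * (5 - (S t).card).factorial :=
  fun _ T S u w hu hw hid hsym => (no_sideSymmetric_of_signPattern D hDσ T S u w hu hw hsym hid).elim

/-- **The `D₅`-reading of S3′ `stub_minimalAsym_five` is FALSE** (S3′ is SIGN-SENSITIVE by theorem): for the determinant pattern
there IS an exact split-rank-one family that is weight-minimal among all exact families (minimise over the exact weights, `≤ 72` by
`sign_five_cheap`) and not side-symmetric (`no_sideSymmetric_of_signPattern`), of weight `< 120`.  Any proof of S3′ for `P₅` must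
therefore use a property of the target that fails when its signs are flipped to `sgn`. -/
theorem not_minimalAsym_of_signPattern (D : (Fin 5 → Fin 5) → ℂ)
    (hDσ : ∀ σ : Equiv.Perm (Fin 5), D ⇑σ = (((Equiv.Perm.sign σ : ℤˣ) : ℤ) : ℂ))
    (hD0 : ∀ v : Fin 5 → Fin 5, ¬ Function.Injective v → D v = 0) :
    ¬ (∀ (N : ℕ) (T : Finset (Fin N)) (S : Fin N → Finset (Fin 5)) (u w : Fin N → (Fin 5 → Fin 5) → ℂ),
        (∀ t, ∀ v v' : Fin 5 → Fin 5, (∀ i ∈ S t, v i = v' i) → u t v = u t v') →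
        (∀ t, ∀ v v' : Fin 5 → Fin 5, (∀ i, i ∉ S t → v i = v' i) → w t v = w t v') →
        (∀ v : Fin 5 → Fin 5, (∑ t ∈ T, u t v * w t v) = D v) →
        (∀ (N' : ℕ) (T' : Finset (Fin N')) (S' : Fin N' → Finset (Fin 5)) (u' w' : Fin N' → (Fin 5 → Fin 5) → ℂ),
          (∀ t, ∀ v v' : Fin 5 → Fin 5, (∀ i ∈ S' t, v i = v' i) → u' t v = u' t v') →
          (∀ t, ∀ v v' : Fin 5 → Fin 5, (∀ i, i ∉ S' t → v i = v' i) → w' t v = w' t v') →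
          (∀ v : Fin 5 → Fin 5, (∑ t ∈ T', u' t v * w' t v) = D v) →
          (∑ t ∈ T, (S t).card.factorial * (5 - (S t).card).factorial)
            ≤ ∑ t ∈ T', (S' t).card.factorial * (5 - (S' t).card).factorial) →
        ¬ SideSymmetric T S u w →
        Nat.factorial 5 ≤ ∑ t ∈ T, (S t).card.factorial * (5 - (S t).card).factorial) := by
  classical
  intro h
  -- the exact weights of `D`
  have hex : ∃ n, ∃ (N : ℕ) (T : Finset (Fin N)) (S : Fin N → Finset (Fin 5)) (u w : Fin N → (Fin 5 → Fin 5) → ℂ),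
      (∀ t, ∀ v v' : Fin 5 → Fin 5, (∀ i ∈ S t, v i = v' i) → u t v = u t v') ∧
      (∀ t, ∀ v v' : Fin 5 → Fin 5, (∀ i, i ∉ S t → v i = v' i) → w t v = w t v') ∧
      (∀ v : Fin 5 → Fin 5, (∑ t ∈ T, u t v * w t v) = D v) ∧
      (∑ t ∈ T, (S t).card.factorial * (5 - (S t).card).factorial) = n := by
    obtain ⟨T, S, u, w, hu, hw, hwt, hid⟩ := exists_cheap_of_signPattern D hDσ hD0
    exact ⟨72, 5, T, S, u, w, hu, hw, hid, hwt⟩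
  have h72 : Nat.find hex ≤ 72 := by
    obtain ⟨T, S, u, w, hu, hw, hwt, hid⟩ := exists_cheap_of_signPattern D hDσ hD0
    exact Nat.find_min' hex ⟨5, T, S, u, w, hu, hw, hid, hwt⟩
  obtain ⟨N₀, T₀, S₀, u₀, w₀, hu₀, hw₀, hid₀, hwt₀⟩ := Nat.find_spec hex
  -- the minimiser is weight-minimal …
  have hmin : ∀ (N' : ℕ) (T' : Finset (Fin N')) (S' : Fin N' → Finset (Fin 5)) (u' w' : Fin N' → (Fin 5 → Fin 5) → ℂ),
      (∀ t, ∀ v v' : Fin 5 → Fin 5, (∀ i ∈ S' t, v i = v' i) → u' t v = u' t v') →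
      (∀ t, ∀ v v' : Fin 5 → Fin 5, (∀ i, i ∉ S' t → v i = v' i) → w' t v = w' t v') →
      (∀ v : Fin 5 → Fin 5, (∑ t ∈ T', u' t v * w' t v) = D v) →
      (∑ t ∈ T₀, (S₀ t).card.factorial * (5 - (S₀ t).card).factorial)
        ≤ ∑ t ∈ T', (S' t).card.factorial * (5 - (S' t).card).factorial := by
    intro N' T' S' u' w' hu' hw' hid'
    rw [hwt₀]
    exact Nat.find_min' hex ⟨N', T', S', u', w', hu', hw', hid', rfl⟩
  -- … and not side-symmetric
  have hns : ¬ SideSymmetric T₀ S₀ u₀ w₀ := fun hs =>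
    no_sideSymmetric_of_signPattern D hDσ T₀ S₀ u₀ w₀ hu₀ hw₀ hs hid₀
  have h120 := h N₀ T₀ S₀ u₀ w₀ hu₀ hw₀ hid₀ hmin hns
  rw [hwt₀] at h120
  have h5 : Nat.factorial 5 = 120 := by decide
  omega

/-- **The `D₅`-reading of young-shadow K2 `AsymLaplaceOptimalFive` is FALSE** as well: the weight-`72` family is exact for `D`,
not side-symmetric, and `72 < 120`. -/
theorem not_asym_of_signPattern (D : (Fin 5 → Fin 5) → ℂ)
    (hDσ : ∀ σ : Equiv.Perm (Fin 5), D ⇑σ = (((Equiv.Perm.sign σ : ℤˣ) : ℤ) : ℂ))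
    (hD0 : ∀ v : Fin 5 → Fin 5, ¬ Function.Injective v → D v = 0) :
    ¬ (∀ (N : ℕ) (T : Finset (Fin N)) (S : Fin N → Finset (Fin 5)) (u w : Fin N → (Fin 5 → Fin 5) → ℂ),
        (∀ t, ∀ v v' : Fin 5 → Fin 5, (∀ i ∈ S t, v i = v' i) → u t v = u t v') →
        (∀ t, ∀ v v' : Fin 5 → Fin 5, (∀ i, i ∉ S t → v i = v' i) → w t v = w t v') →
        (∀ v : Fin 5 → Fin 5, (∑ t ∈ T, u t v * w t v) = D v) →
        ¬ SideSymmetric T S u w →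
        Nat.factorial 5 ≤ ∑ t ∈ T, (S t).card.factorial * (5 - (S t).card).factorial) := by
  intro h
  obtain ⟨T, S, u, w, hu, hw, hwt, hid⟩ := exists_cheap_of_signPattern D hDσ hD0
  have hns : ¬ SideSymmetric T S u w := fun hs => no_sideSymmetric_of_signPattern D hDσ T S u w hu hw hs hid
  have h120 := h 5 T S u w hu hw hid hns
  rw [hwt] at h120
  have h5 : Nat.factorial 5 = 120 := by decide
  omega

end Summit.ValiantsHypothesis.ValiantsHypothesis.Theorems.LaplaceOptimalFiveNegative.SectorSignCalibration
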